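import Literature.NumberTheory.EllipticCurves.BinaryQuarticDiscriminantIntervalProofs
import Mathlib.Algebra.MvPolynomial.SchwartzZippel
import Mathlib.RingTheory.MvPolynomial.Homogeneous
import Mathlib.Data.Nat.Factorization.Basic
import Mathlib.Algebra.Polynomial.Degree.SmallDegree
import HarnessLib

/-!
# The geometric sieve for binary quartic forms at `Y = {Δ = ∂Δ/∂e = 0}`:
# `#{f ∈ [−T,T]⁵ : f (mod p) ∈ Y(𝔽_p) for some prime p > M} ≤ 6144·T⁵/M + 441·(2T+1)⁴`

`Proofs` companion (theorems only: no definitions, no named facts) of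
`BinaryQuarticDiscriminantStrata.lean` / `BinaryQuarticDiscriminantFpCountProofs.lean` /
`BinaryQuarticDiscriminantLiftProofs.lean` (the stratum `Y = {Δ = ∂Δ/∂e = 0} ⊂ V ≅ 𝔸⁵`,
`#Y(ℤ/p) ≤ 6p³`, strong divisibility `⇒ f (mod p) ∈ Y`). Source: M. Bhargava, A. Shankar, *Binary
quartic forms having bounded invariants, and the boundedness of the average rank of elliptic
curves*, Ann. of Math. (2) 181 (2015) 191–242; theorem numbers are those of the published version
(= `arXiv:1006.1002v3`), §2.6.

## The step of the source formalised here

The uniformity estimate Thm 2.13 (`N(∪_{p>M} W_p(V); X) = O(X^{5/6}/log M)·(1 + o(1))`,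
`W_p = {p² ∣ Δ}`) is proved in the source by splitting `W_p = W_p^{(1)} ⊔ W_p^{(2)}` (strong/weak
divisibility). For `W_p^{(1)}` the source invokes (Thm 2.18) the quantitative Ekedahl sieve of
[geosieve, Thm 3.3] (= Thm 2.17): for a compact region `B ⊂ ℝⁿ` and a closed subscheme
`Y ⊂ 𝔸ⁿ_ℤ` of codimension `k ≥ 2`,
`#{v ∈ rB ∩ ℤⁿ : v (mod p) ∈ Y(𝔽_p) for some prime p > M} = O(rⁿ/(M^{k−1} log M) + r^{n−k+1})`,
applied with `n = 5`, `k = 2`, `r = X^{1/6}` and "`Y` the codimension 2 subscheme of `V ≅ 𝔸⁵`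
defined by the vanishing of `Δ` and `∂Δ/∂e`", since a form whose discriminant is strongly divisible
by `p²` reduces into `Y(𝔽_p)`. This file PROVES that instance of the geometric sieve directly (with
`M log M` weakened to `M`, which is all the sieve of §2.7 uses: the bound need only tend to `0` with
`1/M` after division by `X^{5/6}`), for boxes `[−T, T]⁵` and hence for every finite set of forms
with coefficients bounded by `T` (the lattice points of the homogeneously expanding region
`𝓕^{(ε)}·R^{(i)}(X)` of Thms 2.18–2.20 have coefficients `O(X^{1/6})`):

* **small primes `M < p ≤ T`** (`card_filter_dvd_disc_dvd_discDerivE_le`): reduction modulo `p`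
  and the count `#Y(ℤ/p) ≤ 6p³` of the companion file give `≤ 6p³((2T+1)/p + 1)⁵ ≤ 6144·T⁵/p²`
  forms per prime, and `∑_{p>M} p⁻² ≤ 1/M` (`sum_primes_Ioc_one_div_sq_le`);
* **large primes `p > T`** (`card_filter_exists_prime_gt_le`,
  `card_filter_exists_prime_gt_dvd_disc_le`): *elimination of `e`*. Writing
  `Δ = A e³ + B e² + C e + E` (`disc_eq_cubic_e`; `A = 256a³`, …) and `∂Δ/∂e = 3Ae² + 2Be + C`, two
  division steps give the Bézout identity `U·Δ + V·∂Δ/∂e = R₀(a,b,c,d)` (`cubic_bezout`) with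
  `R₀ = Cλ₁² − 2Bλ₀λ₁ + 3Aλ₀²`, `λ₁ = 6AC − 2B²`, `λ₀ = 9AE − BC` (`R₀ = −9A·disc_e(Δ)`), a
  homogeneous polynomial of degree `21` in `a, b, c, d` with `R₀(1,1,1,1) = 115200000000 ≠ 0`.
  Hence a prime dividing `Δ(f)` and `∂Δ/∂e(f)` divides `R₀(a,b,c,d)`
  (`dvd_cubicResultant_of_dvd_disc`). The quadruples `(a,b,c,d) ∈ [−T,T]⁴` with `R₀ = 0` number
  `≤ 21(2T+1)³` by the Schwartz–Zippel lemma (`card_filter_cubicResultant_eq_zero_le`, Mathlib's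
  `MvPolynomial.schwartz_zippel_totalDegree`); for the others `|R₀| < 2⁴⁹T²¹ ≤ T⁷⁰`
  (`abs_cubicResultant_le`), so at most `70` primes `p > T` divide `R₀`
  (`card_primeFactors_cubicResultant_le`), and for each such `p` at most `6` values `e ∈ [−T, T]`
  have `p ∣ Δ` (`card_filter_Icc_dvd_disc_le_six`: modulo `p` the cubic `Δ(a,b,c,d,·)` is nonzero —
  else `p ∣ 256a³`, `p ∣ 27b⁴` force `a = b = 0` and `R₀ = 0` — so has `≤ 3` roots, each residue
  class meeting `[−T,T]` at most twice). Total `≤ (21 + 420)(2T+1)⁴`.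
* **assembled** (`card_filter_exists_prime_gt_dvd_disc_dvd_discDerivE_le`): for `T ≥ 3`, `M ≥ 4`
  and `B` any finite set of integral forms with coefficients in `[−T, T]`,
  `#{f ∈ B : ∃ p > M prime, p ∣ Δ(f), p ∣ ∂Δ/∂e(f)} ≤ 6144·T⁵/M + 441·(2T+1)⁴`, and the same for
  the strongly divisible forms `∪_{p>M} W_p^{(1)}`
  (`card_filter_exists_prime_gt_stronglyDivisible_le`) — Thm 2.18 for boxes.

The weakly divisible part `W_p^{(2)}` (Thms 2.19–2.20: [dodqf, Prop. 23] and Prop. 2.16 via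
Delone–Evertse for `p ≥ X^{1/6}`; the elementary interval count of
`BinaryQuarticDiscriminantIntervalProofs` for `p < X^{1/6}`) is not touched here.

## References

* M. Bhargava, A. Shankar, Ann. of Math. (2) 181 (2015) 191–242, §2.6, Thms 2.13, 2.17, 2.18
  (published numbering = arXiv:1006.1002v3). [cite: BhargavaShankarAnnals2015, §2.6, Thms 2.17–2.18 (published numbering)]
* M. Bhargava, *The geometric sieve and the density of squarefree values of invariant
  polynomials*, arXiv:1402.0031, Thm 3.3 (cited through the source as [geosieve]).
* The Schwartz–Zippel lemma (Mathlib `MvPolynomial.schwartz_zippel_totalDegree`); the Bézout /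
  resultant identity for a cubic and its derivative is classical. [folklore]
-/

noncomputable section

open scoped Classical
open Finset

namespace Literature.NumberTheory.EllipticCurves

namespace BinaryQuartic

/-! ## §1. Elimination of `e` from a cubic and its derivative -/

/-- **Bézout identity for a cubic and its derivative.** For `D = A e³ + B e² + C e + E` and
`D' = 3A e² + 2B e + C` one has `U·D + V·D' = R₀` with `U`, `V` explicit polynomials in `e` and
`R₀ = C λ₁² − 2B λ₀ λ₁ + 3A λ₀²`, `λ₁ = 6AC − 2B²`, `λ₀ = 9AE − BC` (`R₀ = −9A · disc(D)`), obtained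
from two division steps: `9A·D − (3Ae + B)·D' = λ₁ e + λ₀` and
`λ₁²·D' − (3Aλ₁ e + 2Bλ₁ − 3Aλ₀)·(λ₁ e + λ₀) = R₀`. [folklore] -/
theorem cubic_bezout {R : Type*} [CommRing R] (A B C E e : R) :
    (-(9 * A * (3 * A * (6 * A * C - 2 * B ^ 2) * e
          + (2 * B * (6 * A * C - 2 * B ^ 2) - 3 * A * (9 * A * E - B * C)))))
        * (A * e ^ 3 + B * e ^ 2 + C * e + E)
      + ((6 * A * C - 2 * B ^ 2) ^ 2
          + (3 * A * (6 * A * C - 2 * B ^ 2) * e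
              + (2 * B * (6 * A * C - 2 * B ^ 2) - 3 * A * (9 * A * E - B * C))) * (3 * A * e + B))
        * (3 * A * e ^ 2 + 2 * B * e + C)
      = C * (6 * A * C - 2 * B ^ 2) ^ 2 - 2 * B * (9 * A * E - B * C) * (6 * A * C - 2 * B ^ 2)
        + 3 * A * (9 * A * E - B * C) ^ 2 := by
  ring

/-- A common divisor of the values `D(e)` and `D'(e)` of a cubic and its derivative divides the
constant `R₀(A,B,C,E) = C λ₁² − 2B λ₀ λ₁ + 3A λ₀²` (`= −9A·disc D`). [folklore] -/
theorem dvd_cubicResultant {R : Type*} [CommRing R] {p A B C E e : R}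
    (h1 : p ∣ A * e ^ 3 + B * e ^ 2 + C * e + E) (h2 : p ∣ 3 * A * e ^ 2 + 2 * B * e + C) :
    p ∣ C * (6 * A * C - 2 * B ^ 2) ^ 2 - 2 * B * (9 * A * E - B * C) * (6 * A * C - 2 * B ^ 2)
        + 3 * A * (9 * A * E - B * C) ^ 2 := by
  rw [← cubic_bezout A B C E e]
  exact dvd_add (dvd_mul_of_dvd_right h1 _) (dvd_mul_of_dvd_right h2 _)

/-! ## §2. The discriminant of a binary quartic as a cubic in `e` -/

/-- `Δ(a,b,c,d,e) = A e³ + B e² + C e + E` with the `e`-coefficients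
`A = 256a³`, `B = −192a²bd − 128a²c² + 144ab²c − 27b⁴`,
`C = 144a²cd² − 6ab²d² − 80abc²d + 16ac⁴ + 18b³cd − 4b²c³`,
`E = −27a²d⁴ + 18abcd³ − 4ac³d² − 4b³d³ + b²c²d²` (`disc_eq_cubic_e`), and
`∂Δ/∂e = 3A e² + 2B e + C`; hence a common divisor of `Δ(f)` and `∂Δ/∂e(f)` divides
`R₀(A,B,C,E)`, a polynomial in `a, b, c, d` alone — the elimination behind "`v (mod p) ∈ Y(𝔽_p)`
for some prime `p > r`" in the geometric sieve (Bhargava–Shankar 2015, Thm 2.17 = [geosieve,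
Thm 3.3], applied in Thm 2.18 to `Y = {Δ = ∂Δ/∂e = 0}`). [cite: BhargavaShankarAnnals2015, §2.6, Thms 2.17–2.18 (published numbering)] -/
theorem dvd_cubicResultant_of_dvd_disc {R : Type*} [CommRing R] {p : R} (f : BinaryQuartic R)
    {A B C E : R} (hA : A = 256 * f.a ^ 3)
    (hB : B = -192 * f.a ^ 2 * f.b * f.d - 128 * f.a ^ 2 * f.c ^ 2 + 144 * f.a * f.b ^ 2 * f.c
        - 27 * f.b ^ 4)
    (hC : C = 144 * f.a ^ 2 * f.c * f.d ^ 2 - 6 * f.a * f.b ^ 2 * f.d ^ 2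
        - 80 * f.a * f.b * f.c ^ 2 * f.d + 16 * f.a * f.c ^ 4 + 18 * f.b ^ 3 * f.c * f.d
        - 4 * f.b ^ 2 * f.c ^ 3)
    (hE : E = -27 * f.a ^ 2 * f.d ^ 4 + 18 * f.a * f.b * f.c * f.d ^ 3 - 4 * f.a * f.c ^ 3 * f.d ^ 2
        - 4 * f.b ^ 3 * f.d ^ 3 + f.b ^ 2 * f.c ^ 2 * f.d ^ 2)
    (h1 : p ∣ f.disc) (h2 : p ∣ f.discDerivE) :
    p ∣ C * (6 * A * C - 2 * B ^ 2) ^ 2 - 2 * B * (9 * A * E - B * C) * (6 * A * C - 2 * B ^ 2)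
        + 3 * A * (9 * A * E - B * C) ^ 2 := by
  have hD : f.disc = A * f.e ^ 3 + B * f.e ^ 2 + C * f.e + E := by
    rw [disc_eq_cubic_e, hA, hB, hC, hE]
  have hD' : f.discDerivE = 3 * A * f.e ^ 2 + 2 * B * f.e + C := by
    rw [discDerivE_eq_quadratic_e, hA, hB, hC]; ring
  exact dvd_cubicResultant (hD ▸ h1) (hD' ▸ h2)

/-- If `a = b = 0` then `A = B = 0` and `R₀ = 0`. [folklore] -/
theorem cubicResultant_eq_zero_of_a_eq_zero_of_b_eq_zero {R : Type*} [CommRing R]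
    {a b c d A B C E : R} (hA : A = 256 * a ^ 3)
    (hB : B = -192 * a ^ 2 * b * d - 128 * a ^ 2 * c ^ 2 + 144 * a * b ^ 2 * c - 27 * b ^ 4)
    (ha : a = 0) (hb : b = 0) :
    C * (6 * A * C - 2 * B ^ 2) ^ 2 - 2 * B * (9 * A * E - B * C) * (6 * A * C - 2 * B ^ 2)
        + 3 * A * (9 * A * E - B * C) ^ 2 = 0 := by
  subst ha hb
  have hA0 : A = 0 := by rw [hA]; ring
  have hB0 : B = 0 := by rw [hB]; ring
  rw [hA0, hB0]; ring

/-! ## §3. At most six values of `e` per large prime -/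

/-- `[−T, T] = [−T, −T + (2T+1))` as finsets of integers. [folklore] -/
theorem Icc_neg_eq_Ico (T : ℕ) :
    Icc (-(T : ℤ)) T = Ico (-(T : ℤ)) (-(T : ℤ) + ((2 * T + 1 : ℕ) : ℤ)) := by
  ext x
  simp only [mem_Icc, mem_Ico]
  push_cast
  omega

/-- For a prime `p > T` each residue class modulo `p` meets `[−T, T]` in at most two integers.
[folklore] -/
theorem card_filter_Icc_intCast_eq_le_two {T p : ℕ} (hp : 0 < p) (hTp : T < p) (r : ZMod p) :
    ((Icc (-(T : ℤ)) T).filter fun e : ℤ => (e : ZMod p) = r).card ≤ 2 := by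
  rw [Icc_neg_eq_Ico]
  refine (card_filter_Ico_intCast_eq_le hp _ _ r).trans ?_
  have : (2 * T + 1) / p < 2 := (Nat.div_lt_iff_lt_mul hp).mpr (by omega)
  omega

open Polynomial in
/-- **At most six `e ∈ [−T, T]` make `p ∣ Δ(a,b,c,d,e)`**, for a prime `p > T ≥ 3`, integers
`|a|, |b| ≤ T` and `(a,b,c,d)` off the hypersurface `R₀ = 0`: then `Δ(a,b,c,d,·)` is a nonzero
cubic modulo `p` (if all its coefficients vanished mod `p`, then `p ∣ 256a³` and `p ∣ 27b⁴` would
force `a = b = 0`, whence `R₀ = 0`), so its roots lie in at most `3` residue classes, each meeting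
`[−T, T]` at most twice. [folklore] -/
theorem card_filter_Icc_dvd_disc_le_six {T : ℕ} (hT : 3 ≤ T) {p : ℕ} (hp : p.Prime) (hTp : T < p)
    {a b c d A B C E : ℤ} (ha : |a| ≤ T) (hb : |b| ≤ T) (hA : A = 256 * a ^ 3)
    (hB : B = -192 * a ^ 2 * b * d - 128 * a ^ 2 * c ^ 2 + 144 * a * b ^ 2 * c - 27 * b ^ 4)
    (hC : C = 144 * a ^ 2 * c * d ^ 2 - 6 * a * b ^ 2 * d ^ 2 - 80 * a * b * c ^ 2 * d
        + 16 * a * c ^ 4 + 18 * b ^ 3 * c * d - 4 * b ^ 2 * c ^ 3)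
    (hE : E = -27 * a ^ 2 * d ^ 4 + 18 * a * b * c * d ^ 3 - 4 * a * c ^ 3 * d ^ 2
        - 4 * b ^ 3 * d ^ 3 + b ^ 2 * c ^ 2 * d ^ 2)
    (hR : C * (6 * A * C - 2 * B ^ 2) ^ 2 - 2 * B * (9 * A * E - B * C) * (6 * A * C - 2 * B ^ 2)
        + 3 * A * (9 * A * E - B * C) ^ 2 ≠ 0) :
    ((Icc (-(T : ℤ)) T).filter fun e : ℤ =>
        (p : ℤ) ∣ (⟨a, b, c, d, e⟩ : BinaryQuartic ℤ).disc).card ≤ 6 := by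
  haveI := Fact.mk hp
  have hp2 : p ≠ 2 := by omega
  have hp3 : p ≠ 3 := by omega
  have hpi : Prime (p : ℤ) := Nat.prime_iff_prime_int.mp hp
  -- the cubic modulo `p`
  set D : (ZMod p)[X] := Polynomial.C ((A : ℤ) : ZMod p) * X ^ 3
      + Polynomial.C ((B : ℤ) : ZMod p) * X ^ 2 + Polynomial.C ((C : ℤ) : ZMod p) * X
      + Polynomial.C ((E : ℤ) : ZMod p) with hDdef
  have hdeg : D.natDegree ≤ 3 := Polynomial.natDegree_cubic_le
  have hD0 : D ≠ 0 := by
    intro h0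
    have h3 : ((A : ℤ) : ZMod p) = 0 := by
      have := congrArg (fun P : (ZMod p)[X] => P.coeff 3) h0
      simp only [hDdef, coeff_add, coeff_C_mul, coeff_X_pow, coeff_X, coeff_C, coeff_zero] at this
      norm_num at this
      exact this
    have h2 : ((B : ℤ) : ZMod p) = 0 := by
      have := congrArg (fun P : (ZMod p)[X] => P.coeff 2) h0
      simp only [hDdef, coeff_add, coeff_C_mul, coeff_X_pow, coeff_X, coeff_C, coeff_zero] at this
      norm_num at this
      exact this
    rw [ZMod.intCast_zmod_eq_zero_iff_dvd] at h3 h2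
    -- `p ∣ 256 a³` forces `a = 0`
    have hpa : (p : ℤ) ∣ a := by
      rw [hA] at h3
      have h256 : ¬ (p : ℤ) ∣ 256 := by
        intro h
        have : (p : ℤ) ∣ (2 : ℤ) ^ 8 := by norm_num at h ⊢; exact h
        have h2' := Int.natAbs_dvd_natAbs.mpr (hpi.dvd_of_dvd_pow this)
        simp only [Int.natAbs_natCast] at h2'
        have := (Nat.prime_dvd_prime_iff_eq hp Nat.prime_two).mp (by simpa using h2')
        exact hp2 this
      exact hpi.dvd_of_dvd_pow ((hpi.dvd_or_dvd h3).resolve_left h256)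
    have ha0 : a = 0 := by
      refine Int.eq_zero_of_abs_lt_dvd hpa ?_
      exact_mod_cast lt_of_le_of_lt ha (by exact_mod_cast hTp)
    have hpb : (p : ℤ) ∣ b := by
      rw [hB, ha0] at h2
      have h2'' : (p : ℤ) ∣ 27 * b ^ 4 := by
        have : (-192 * (0:ℤ) ^ 2 * b * d - 128 * 0 ^ 2 * c ^ 2 + 144 * 0 * b ^ 2 * c - 27 * b ^ 4)
            = -(27 * b ^ 4) := by ring
        rw [this, dvd_neg] at h2; exact h2
      have h27 : ¬ (p : ℤ) ∣ 27 := by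
        intro h
        have : (p : ℤ) ∣ (3 : ℤ) ^ 3 := by norm_num at h ⊢; exact h
        have h3' := Int.natAbs_dvd_natAbs.mpr (hpi.dvd_of_dvd_pow this)
        simp only [Int.natAbs_natCast] at h3'
        have := (Nat.prime_dvd_prime_iff_eq hp Nat.prime_three).mp (by simpa using h3')
        exact hp3 this
      exact hpi.dvd_of_dvd_pow ((hpi.dvd_or_dvd h2'').resolve_left h27)
    have hb0 : b = 0 := by
      refine Int.eq_zero_of_abs_lt_dvd hpb ?_
      exact_mod_cast lt_of_le_of_lt hb (by exact_mod_cast hTp)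
    exact hR (cubicResultant_eq_zero_of_a_eq_zero_of_b_eq_zero hA hB ha0 hb0)
  -- roots of `D`
  set Rt : Finset (ZMod p) := univ.filter fun r : ZMod p => D.eval r = 0 with hRt
  have hRt3 : Rt.card ≤ 3 := card_filter_eval_eq_zero_le hD0 hdeg
  have key := card_le_mul_card_image_of_maps_to
    (s := (Icc (-(T : ℤ)) T).filter fun e : ℤ => (p : ℤ) ∣ (⟨a, b, c, d, e⟩ : BinaryQuartic ℤ).disc)
    (t := Rt) (f := fun e : ℤ => (e : ZMod p)) (fun e he => ?_) 2 (fun r _ => ?_)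
  · calc _ ≤ 2 * Rt.card := key
      _ ≤ 2 * 3 := Nat.mul_le_mul_left _ hRt3
      _ = 6 := rfl
  · simp only [mem_filter] at he
    obtain ⟨-, he⟩ := he
    simp only [hRt, mem_filter, mem_univ, true_and]
    have hD : (⟨a, b, c, d, e⟩ : BinaryQuartic ℤ).disc = A * e ^ 3 + B * e ^ 2 + C * e + E := by
      rw [disc_eq_cubic_e, hA, hB, hC, hE]
    rw [hD, ← ZMod.intCast_zmod_eq_zero_iff_dvd] at he
    push_cast at he
    simpa [hDdef] using he
  · exact (card_le_card (filter_subset_filter _ (filter_subset _ _))).trans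
      (card_filter_Icc_intCast_eq_le_two hp.pos hTp r)


/-! ## §4. The size of `R₀` on a box and the number of its large prime factors -/

/-- `|k · m| ≤ |k| · M` when `|m| ≤ M`. [folklore] -/
theorem abs_const_mul_le {k m M : ℤ} (hm : |m| ≤ M) : |k * m| ≤ |k| * M := by
  rw [abs_mul]; exact mul_le_mul_of_nonneg_left hm (abs_nonneg k)

/-- **`|R₀(a,b,c,d)| ≤ 489137627996768 · T²¹ < 2⁴⁹ T²¹` for `|a|, |b|, |c|, |d| ≤ T`**, from
`|A| ≤ 256T³`, `|B| ≤ 491T⁴`, `|C| ≤ 268T⁵`, `|E| ≤ 54T⁶` (sums of the absolute values of the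
coefficients), `|λ₁| ≤ 893810 T⁸`, `|λ₀| ≤ 256004 T⁹`. [folklore] -/
theorem abs_cubicResultant_le {T : ℕ} {a b c d A B C E : ℤ} (ha : |a| ≤ T) (hb : |b| ≤ T)
    (hc : |c| ≤ T) (hd : |d| ≤ T) (hA : A = 256 * a ^ 3)
    (hB : B = -192 * a ^ 2 * b * d - 128 * a ^ 2 * c ^ 2 + 144 * a * b ^ 2 * c - 27 * b ^ 4)
    (hC : C = 144 * a ^ 2 * c * d ^ 2 - 6 * a * b ^ 2 * d ^ 2 - 80 * a * b * c ^ 2 * d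
        + 16 * a * c ^ 4 + 18 * b ^ 3 * c * d - 4 * b ^ 2 * c ^ 3)
    (hE : E = -27 * a ^ 2 * d ^ 4 + 18 * a * b * c * d ^ 3 - 4 * a * c ^ 3 * d ^ 2
        - 4 * b ^ 3 * d ^ 3 + b ^ 2 * c ^ 2 * d ^ 2) :
    |C * (6 * A * C - 2 * B ^ 2) ^ 2 - 2 * B * (9 * A * E - B * C) * (6 * A * C - 2 * B ^ 2)
        + 3 * A * (9 * A * E - B * C) ^ 2| ≤ 489137627996768 * (T : ℤ) ^ 21 := by
  have h0 : (0 : ℤ) ≤ T := by positivity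
  have ha0 := abs_nonneg a
  have hb0 := abs_nonneg b
  have hc0 := abs_nonneg c
  have hd0 := abs_nonneg d
  -- the four coefficients
  have hA' : |A| ≤ 256 * (T : ℤ) ^ 3 := by
    rw [hA, abs_mul, abs_pow, abs_of_nonneg (by norm_num : (0:ℤ) ≤ 256)]
    gcongr
  have hB' : |B| ≤ 491 * (T : ℤ) ^ 4 := by
    have e1 : B = (-192) * (a ^ 2 * b * d) + ((-128) * (a ^ 2 * c ^ 2) + (144 * (a * b ^ 2 * c)
        + (-27) * b ^ 4)) := by rw [hB]; ring
    rw [e1]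
    have m1 : |a ^ 2 * b * d| ≤ (T : ℤ) ^ 2 * T * T := by
      rw [abs_mul, abs_mul, abs_pow]; gcongr
    have m2 : |a ^ 2 * c ^ 2| ≤ (T : ℤ) ^ 2 * T ^ 2 := by
      rw [abs_mul, abs_pow, abs_pow]; gcongr
    have m3 : |a * b ^ 2 * c| ≤ (T : ℤ) * T ^ 2 * T := by
      rw [abs_mul, abs_mul, abs_pow]; gcongr
    have m4 : |b ^ 4| ≤ (T : ℤ) ^ 4 := by
      rw [abs_pow]; gcongr
    calc _ ≤ |(-192) * (a ^ 2 * b * d)| + (|(-128) * (a ^ 2 * c ^ 2)| + (|144 * (a * b ^ 2 * c)|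
          + |(-27) * b ^ 4|)) :=
          (abs_add_le _ _).trans (add_le_add le_rfl ((abs_add_le _ _).trans
            (add_le_add le_rfl (abs_add_le _ _))))
      _ ≤ |(-192 : ℤ)| * ((T : ℤ) ^ 2 * T * T) + (|(-128 : ℤ)| * ((T : ℤ) ^ 2 * T ^ 2)
          + (|(144 : ℤ)| * ((T : ℤ) * T ^ 2 * T) + |(-27 : ℤ)| * (T : ℤ) ^ 4)) :=
          add_le_add (abs_const_mul_le m1) (add_le_add (abs_const_mul_le m2)
            (add_le_add (abs_const_mul_le m3) (abs_const_mul_le m4)))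
      _ = 491 * (T : ℤ) ^ 4 := by norm_num; ring
  have hC' : |C| ≤ 268 * (T : ℤ) ^ 5 := by
    have e1 : C = 144 * (a ^ 2 * c * d ^ 2) + ((-6) * (a * b ^ 2 * d ^ 2)
        + ((-80) * (a * b * c ^ 2 * d) + (16 * (a * c ^ 4) + (18 * (b ^ 3 * c * d)
        + (-4) * (b ^ 2 * c ^ 3))))) := by rw [hC]; ring
    rw [e1]
    have m1 : |a ^ 2 * c * d ^ 2| ≤ (T : ℤ) ^ 2 * T * T ^ 2 := by
      rw [abs_mul, abs_mul, abs_pow, abs_pow]; gcongr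
    have m2 : |a * b ^ 2 * d ^ 2| ≤ (T : ℤ) * T ^ 2 * T ^ 2 := by
      rw [abs_mul, abs_mul, abs_pow, abs_pow]; gcongr
    have m3 : |a * b * c ^ 2 * d| ≤ (T : ℤ) * T * T ^ 2 * T := by
      rw [abs_mul, abs_mul, abs_mul, abs_pow]; gcongr
    have m4 : |a * c ^ 4| ≤ (T : ℤ) * T ^ 4 := by
      rw [abs_mul, abs_pow]; gcongr
    have m5 : |b ^ 3 * c * d| ≤ (T : ℤ) ^ 3 * T * T := by
      rw [abs_mul, abs_mul, abs_pow]; gcongr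
    have m6 : |b ^ 2 * c ^ 3| ≤ (T : ℤ) ^ 2 * T ^ 3 := by
      rw [abs_mul, abs_pow, abs_pow]; gcongr
    calc _ ≤ |144 * (a ^ 2 * c * d ^ 2)| + (|(-6) * (a * b ^ 2 * d ^ 2)|
          + (|(-80) * (a * b * c ^ 2 * d)| + (|16 * (a * c ^ 4)| + (|18 * (b ^ 3 * c * d)|
          + |(-4) * (b ^ 2 * c ^ 3)|)))) :=
          (abs_add_le _ _).trans (add_le_add le_rfl ((abs_add_le _ _).trans (add_le_add le_rfl
            ((abs_add_le _ _).trans (add_le_add le_rfl ((abs_add_le _ _).trans (add_le_add le_rfl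
              (abs_add_le _ _))))))))
      _ ≤ |(144 : ℤ)| * ((T : ℤ) ^ 2 * T * T ^ 2) + (|(-6 : ℤ)| * ((T : ℤ) * T ^ 2 * T ^ 2)
          + (|(-80 : ℤ)| * ((T : ℤ) * T * T ^ 2 * T) + (|(16 : ℤ)| * ((T : ℤ) * T ^ 4)
          + (|(18 : ℤ)| * ((T : ℤ) ^ 3 * T * T) + |(-4 : ℤ)| * ((T : ℤ) ^ 2 * T ^ 3))))) :=
          add_le_add (abs_const_mul_le m1) (add_le_add (abs_const_mul_le m2)
            (add_le_add (abs_const_mul_le m3) (add_le_add (abs_const_mul_le m4)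
              (add_le_add (abs_const_mul_le m5) (abs_const_mul_le m6)))))
      _ = 268 * (T : ℤ) ^ 5 := by norm_num; ring
  have hE' : |E| ≤ 54 * (T : ℤ) ^ 6 := by
    have e1 : E = (-27) * (a ^ 2 * d ^ 4) + (18 * (a * b * c * d ^ 3)
        + ((-4) * (a * c ^ 3 * d ^ 2) + ((-4) * (b ^ 3 * d ^ 3) + 1 * (b ^ 2 * c ^ 2 * d ^ 2)))) := by
      rw [hE]; ring
    rw [e1]
    have m1 : |a ^ 2 * d ^ 4| ≤ (T : ℤ) ^ 2 * T ^ 4 := by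
      rw [abs_mul, abs_pow, abs_pow]; gcongr
    have m2 : |a * b * c * d ^ 3| ≤ (T : ℤ) * T * T * T ^ 3 := by
      rw [abs_mul, abs_mul, abs_mul, abs_pow]; gcongr
    have m3 : |a * c ^ 3 * d ^ 2| ≤ (T : ℤ) * T ^ 3 * T ^ 2 := by
      rw [abs_mul, abs_mul, abs_pow, abs_pow]; gcongr
    have m4 : |b ^ 3 * d ^ 3| ≤ (T : ℤ) ^ 3 * T ^ 3 := by
      rw [abs_mul, abs_pow, abs_pow]; gcongr
    have m5 : |b ^ 2 * c ^ 2 * d ^ 2| ≤ (T : ℤ) ^ 2 * T ^ 2 * T ^ 2 := by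
      rw [abs_mul, abs_mul, abs_pow, abs_pow, abs_pow]; gcongr
    calc _ ≤ |(-27) * (a ^ 2 * d ^ 4)| + (|18 * (a * b * c * d ^ 3)|
          + (|(-4) * (a * c ^ 3 * d ^ 2)| + (|(-4) * (b ^ 3 * d ^ 3)|
          + |1 * (b ^ 2 * c ^ 2 * d ^ 2)|))) :=
          (abs_add_le _ _).trans (add_le_add le_rfl ((abs_add_le _ _).trans (add_le_add le_rfl
            ((abs_add_le _ _).trans (add_le_add le_rfl (abs_add_le _ _))))))
      _ ≤ |(-27 : ℤ)| * ((T : ℤ) ^ 2 * T ^ 4) + (|(18 : ℤ)| * ((T : ℤ) * T * T * T ^ 3)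
          + (|(-4 : ℤ)| * ((T : ℤ) * T ^ 3 * T ^ 2) + (|(-4 : ℤ)| * ((T : ℤ) ^ 3 * T ^ 3)
          + |(1 : ℤ)| * ((T : ℤ) ^ 2 * T ^ 2 * T ^ 2)))) :=
          add_le_add (abs_const_mul_le m1) (add_le_add (abs_const_mul_le m2)
            (add_le_add (abs_const_mul_le m3) (add_le_add (abs_const_mul_le m4)
              (abs_const_mul_le m5))))
      _ = 54 * (T : ℤ) ^ 6 := by norm_num; ring
  have hA0 := abs_nonneg A
  have hB0 := abs_nonneg B
  have hC0 := abs_nonneg C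
  have hE0 := abs_nonneg E
  -- `λ₁`, `λ₀`
  have hl1 : |6 * A * C - 2 * B ^ 2| ≤ 893810 * (T : ℤ) ^ 8 := by
    calc _ ≤ |6 * A * C| + |2 * B ^ 2| := abs_sub _ _
      _ = 6 * |A| * |C| + 2 * |B| ^ 2 := by
          rw [abs_mul, abs_mul, abs_mul, abs_pow]; norm_num
      _ ≤ 6 * (256 * (T : ℤ) ^ 3) * (268 * (T : ℤ) ^ 5) + 2 * (491 * (T : ℤ) ^ 4) ^ 2 := by
          gcongr
      _ = 893810 * (T : ℤ) ^ 8 := by ring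
  have hl0 : |9 * A * E - B * C| ≤ 256004 * (T : ℤ) ^ 9 := by
    calc _ ≤ |9 * A * E| + |B * C| := abs_sub _ _
      _ = 9 * |A| * |E| + |B| * |C| := by
          rw [abs_mul, abs_mul, abs_mul]; norm_num
      _ ≤ 9 * (256 * (T : ℤ) ^ 3) * (54 * (T : ℤ) ^ 6) + (491 * (T : ℤ) ^ 4) * (268 * (T : ℤ) ^ 5) := by
          gcongr
      _ = 256004 * (T : ℤ) ^ 9 := by ring
  have hl10 := abs_nonneg (6 * A * C - 2 * B ^ 2)
  have hl00 := abs_nonneg (9 * A * E - B * C)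
  calc _ ≤ |C * (6 * A * C - 2 * B ^ 2) ^ 2 - 2 * B * (9 * A * E - B * C) * (6 * A * C - 2 * B ^ 2)|
        + |3 * A * (9 * A * E - B * C) ^ 2| := abs_add_le _ _
    _ ≤ |C * (6 * A * C - 2 * B ^ 2) ^ 2| + |2 * B * (9 * A * E - B * C) * (6 * A * C - 2 * B ^ 2)|
        + |3 * A * (9 * A * E - B * C) ^ 2| := add_le_add (abs_sub _ _) le_rfl
    _ = |C| * |6 * A * C - 2 * B ^ 2| ^ 2 + 2 * |B| * |9 * A * E - B * C| * |6 * A * C - 2 * B ^ 2|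
        + 3 * |A| * |9 * A * E - B * C| ^ 2 := by
        rw [abs_mul, abs_pow, abs_mul, abs_mul, abs_mul, abs_mul, abs_mul, abs_pow]; norm_num
    _ ≤ (268 * (T : ℤ) ^ 5) * (893810 * (T : ℤ) ^ 8) ^ 2
        + 2 * (491 * (T : ℤ) ^ 4) * (256004 * (T : ℤ) ^ 9) * (893810 * (T : ℤ) ^ 8)
        + 3 * (256 * (T : ℤ) ^ 3) * (256004 * (T : ℤ) ^ 9) ^ 2 := by gcongr
    _ = 489137627996768 * (T : ℤ) ^ 21 := by ring

/-- **A natural number `N ≠ 0` with `N ≤ T^k`, `T ≥ 2`, has at most `k` prime factors exceeding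
`T`** (their product divides `N` and exceeds `T^{#}`). [folklore] -/
theorem card_primeFactors_filter_lt_le {N T k : ℕ} (hT : 2 ≤ T) (hN : N ≠ 0) (hNT : N ≤ T ^ k) :
    (N.primeFactors.filter fun p => T < p).card ≤ k := by
  set P := N.primeFactors.filter fun p => T < p with hP
  have h1 : T ^ P.card ≤ ∏ p ∈ P, p :=
    Finset.pow_card_le_prod P (fun p => p) T fun p hp => (mem_filter.mp hp).2.le
  have h2 : ∏ p ∈ P, p ∣ N :=
    (Finset.prod_dvd_prod_of_subset _ _ _ (filter_subset _ _)).trans (Nat.prod_primeFactors_dvd N)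
  have h3 : ∏ p ∈ P, p ≤ N := Nat.le_of_dvd (Nat.pos_of_ne_zero hN) h2
  exact (Nat.pow_le_pow_iff_right (by omega)).mp ((h1.trans h3).trans hNT)

/-- **At most `70` primes `p > T` divide a nonzero value `R₀(a,b,c,d)` on the box `|·| ≤ T`**
(`T ≥ 2`): `|R₀| < 2⁴⁹ T²¹ ≤ T⁷⁰`. [folklore] -/
theorem card_primeFactors_cubicResultant_le {T : ℕ} (hT : 2 ≤ T) {a b c d A B C E : ℤ}
    (ha : |a| ≤ T) (hb : |b| ≤ T) (hc : |c| ≤ T) (hd : |d| ≤ T) (hA : A = 256 * a ^ 3)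
    (hB : B = -192 * a ^ 2 * b * d - 128 * a ^ 2 * c ^ 2 + 144 * a * b ^ 2 * c - 27 * b ^ 4)
    (hC : C = 144 * a ^ 2 * c * d ^ 2 - 6 * a * b ^ 2 * d ^ 2 - 80 * a * b * c ^ 2 * d
        + 16 * a * c ^ 4 + 18 * b ^ 3 * c * d - 4 * b ^ 2 * c ^ 3)
    (hE : E = -27 * a ^ 2 * d ^ 4 + 18 * a * b * c * d ^ 3 - 4 * a * c ^ 3 * d ^ 2
        - 4 * b ^ 3 * d ^ 3 + b ^ 2 * c ^ 2 * d ^ 2)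
    (hR : C * (6 * A * C - 2 * B ^ 2) ^ 2 - 2 * B * (9 * A * E - B * C) * (6 * A * C - 2 * B ^ 2)
        + 3 * A * (9 * A * E - B * C) ^ 2 ≠ 0) :
    ((C * (6 * A * C - 2 * B ^ 2) ^ 2 - 2 * B * (9 * A * E - B * C) * (6 * A * C - 2 * B ^ 2)
        + 3 * A * (9 * A * E - B * C) ^ 2).natAbs.primeFactors.filter fun p => T < p).card ≤ 70 := by
  refine card_primeFactors_filter_lt_le hT (Int.natAbs_ne_zero.mpr hR) ?_
  have hsize := abs_cubicResultant_le ha hb hc hd hA hB hC hE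
  have hK : (489137627996768 : ℤ) * (T : ℤ) ^ 21 ≤ (T : ℤ) ^ 70 := by
    have h2 : (489137627996768 : ℤ) ≤ (T : ℤ) ^ 49 :=
      calc (489137627996768 : ℤ) ≤ 2 ^ 49 := by norm_num
        _ ≤ (T : ℤ) ^ 49 := by gcongr; exact_mod_cast hT
    calc (489137627996768 : ℤ) * (T : ℤ) ^ 21 ≤ (T : ℤ) ^ 49 * (T : ℤ) ^ 21 := by gcongr
      _ = (T : ℤ) ^ 70 := by ring
  have : ((C * (6 * A * C - 2 * B ^ 2) ^ 2 - 2 * B * (9 * A * E - B * C) * (6 * A * C - 2 * B ^ 2)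
        + 3 * A * (9 * A * E - B * C) ^ 2).natAbs : ℤ) ≤ (T : ℤ) ^ 70 := by
    rw [Int.natCast_natAbs]; exact hsize.trans hK
  exact_mod_cast this


/-! ## §5. `R₀` vanishes at no more than `21·#S³` points of `S⁴` (Schwartz–Zippel) -/

/-- Transport of homogeneity along an equality of degrees. [folklore] -/
theorem isHomogeneous_of_deg_eq {σ R : Type*} [CommSemiring R] {φ : MvPolynomial σ R} {m n : ℕ}
    (h : φ.IsHomogeneous m) (e : m = n) : φ.IsHomogeneous n := e ▸ h

/-- **`#{(a,b,c,d) ∈ S⁴ : R₀(a,b,c,d) = 0} ≤ 21 · #S³`** for every finite set `S` of integers: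
`R₀` is a nonzero (`R₀(1,1,1,1) = 115200000000`) homogeneous polynomial of degree `21` in
`ℤ[a,b,c,d]`, and the Schwartz–Zippel lemma applies. This is the "`O(r^{n−k+1})`" hyperplane-slice
count of the geometric sieve (Bhargava–Shankar 2015, Thm 2.17 = [geosieve, Thm 3.3]) for
`Y = {Δ = ∂Δ/∂e = 0}`. [cite: BhargavaShankarAnnals2015, §2.6, Thm 2.17 (published numbering)] -/
theorem card_filter_cubicResultant_eq_zero_le (S : Finset ℤ) :
    ((Fintype.piFinset fun _ : Fin 4 => S).filter fun y : Fin 4 → ℤ =>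
        (let a := y 0; let b := y 1; let c := y 2; let d := y 3
         let A := 256 * a ^ 3
         let B := -192 * a ^ 2 * b * d - 128 * a ^ 2 * c ^ 2 + 144 * a * b ^ 2 * c - 27 * b ^ 4
         let C := 144 * a ^ 2 * c * d ^ 2 - 6 * a * b ^ 2 * d ^ 2 - 80 * a * b * c ^ 2 * d
           + 16 * a * c ^ 4 + 18 * b ^ 3 * c * d - 4 * b ^ 2 * c ^ 3
         let E := -27 * a ^ 2 * d ^ 4 + 18 * a * b * c * d ^ 3 - 4 * a * c ^ 3 * d ^ 2
           - 4 * b ^ 3 * d ^ 3 + b ^ 2 * c ^ 2 * d ^ 2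
         C * (6 * A * C - 2 * B ^ 2) ^ 2 - 2 * B * (9 * A * E - B * C) * (6 * A * C - 2 * B ^ 2)
           + 3 * A * (9 * A * E - B * C) ^ 2 = 0)).card ≤ 21 * S.card ^ 3 := by
  classical
  -- `R₀` as a polynomial in four variables
  set Pa : MvPolynomial (Fin 4) ℤ := MvPolynomial.C 256 * MvPolynomial.X 0 ^ 3 with hPa
  set Pb : MvPolynomial (Fin 4) ℤ :=
      MvPolynomial.C (-192) * MvPolynomial.X 0 ^ 2 * MvPolynomial.X 1 * MvPolynomial.X 3
      + MvPolynomial.C (-128) * MvPolynomial.X 0 ^ 2 * MvPolynomial.X 2 ^ 2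
      + MvPolynomial.C 144 * MvPolynomial.X 0 * MvPolynomial.X 1 ^ 2 * MvPolynomial.X 2
      + MvPolynomial.C (-27) * MvPolynomial.X 1 ^ 4 with hPb
  set Pc : MvPolynomial (Fin 4) ℤ :=
      MvPolynomial.C 144 * MvPolynomial.X 0 ^ 2 * MvPolynomial.X 2 * MvPolynomial.X 3 ^ 2
      + MvPolynomial.C (-6) * MvPolynomial.X 0 * MvPolynomial.X 1 ^ 2 * MvPolynomial.X 3 ^ 2
      + MvPolynomial.C (-80) * MvPolynomial.X 0 * MvPolynomial.X 1 * MvPolynomial.X 2 ^ 2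
          * MvPolynomial.X 3
      + MvPolynomial.C 16 * MvPolynomial.X 0 * MvPolynomial.X 2 ^ 4
      + MvPolynomial.C 18 * MvPolynomial.X 1 ^ 3 * MvPolynomial.X 2 * MvPolynomial.X 3
      + MvPolynomial.C (-4) * MvPolynomial.X 1 ^ 2 * MvPolynomial.X 2 ^ 3 with hPc
  set Pe : MvPolynomial (Fin 4) ℤ :=
      MvPolynomial.C (-27) * MvPolynomial.X 0 ^ 2 * MvPolynomial.X 3 ^ 4
      + MvPolynomial.C 18 * MvPolynomial.X 0 * MvPolynomial.X 1 * MvPolynomial.X 2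
          * MvPolynomial.X 3 ^ 3
      + MvPolynomial.C (-4) * MvPolynomial.X 0 * MvPolynomial.X 2 ^ 3 * MvPolynomial.X 3 ^ 2
      + MvPolynomial.C (-4) * MvPolynomial.X 1 ^ 3 * MvPolynomial.X 3 ^ 3
      + MvPolynomial.C 1 * MvPolynomial.X 1 ^ 2 * MvPolynomial.X 2 ^ 2 * MvPolynomial.X 3 ^ 2
      with hPe
  set P : MvPolynomial (Fin 4) ℤ :=
      Pc * (MvPolynomial.C 6 * Pa * Pc - MvPolynomial.C 2 * Pb ^ 2) ^ 2
      - MvPolynomial.C 2 * Pb * (MvPolynomial.C 9 * Pa * Pe - Pb * Pc)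
          * (MvPolynomial.C 6 * Pa * Pc - MvPolynomial.C 2 * Pb ^ 2)
      + MvPolynomial.C 3 * Pa * (MvPolynomial.C 9 * Pa * Pe - Pb * Pc) ^ 2 with hP
  -- homogeneity
  have hX : ∀ i : Fin 4, (MvPolynomial.X i : MvPolynomial (Fin 4) ℤ).IsHomogeneous 1 :=
    fun i => MvPolynomial.isHomogeneous_X ℤ i
  have hXp : ∀ (i : Fin 4) (n : ℕ), (MvPolynomial.X i ^ n : MvPolynomial (Fin 4) ℤ).IsHomogeneous n :=
    fun i n => MvPolynomial.isHomogeneous_X_pow (R := ℤ) i n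
  have hCXp : ∀ (r : ℤ) (i : Fin 4) (n : ℕ),
      (MvPolynomial.C r * MvPolynomial.X i ^ n : MvPolynomial (Fin 4) ℤ).IsHomogeneous n :=
    fun r i n => MvPolynomial.isHomogeneous_C_mul_X_pow r i n
  have hCX : ∀ (r : ℤ) (i : Fin 4),
      (MvPolynomial.C r * MvPolynomial.X i : MvPolynomial (Fin 4) ℤ).IsHomogeneous 1 :=
    fun r i => MvPolynomial.isHomogeneous_C_mul_X r i
  have hPa' : Pa.IsHomogeneous 3 := hCXp 256 0 3
  have hPb' : Pb.IsHomogeneous 4 :=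
    (((isHomogeneous_of_deg_eq (((hCXp (-192) 0 2).mul (hX 1)).mul (hX 3)) (by norm_num)).add
      (isHomogeneous_of_deg_eq ((hCXp (-128) 0 2).mul (hXp 2 2)) (by norm_num))).add
      (isHomogeneous_of_deg_eq (((hCX 144 0).mul (hXp 1 2)).mul (hX 2)) (by norm_num))).add
      (hCXp (-27) 1 4)
  have hPc' : Pc.IsHomogeneous 5 :=
    (((((isHomogeneous_of_deg_eq (((hCXp 144 0 2).mul (hX 2)).mul (hXp 3 2)) (by norm_num)).add
      (isHomogeneous_of_deg_eq (((hCX (-6) 0).mul (hXp 1 2)).mul (hXp 3 2)) (by norm_num))).add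
      (isHomogeneous_of_deg_eq ((((hCX (-80) 0).mul (hX 1)).mul (hXp 2 2)).mul (hX 3))
        (by norm_num))).add
      (isHomogeneous_of_deg_eq ((hCX 16 0).mul (hXp 2 4)) (by norm_num))).add
      (isHomogeneous_of_deg_eq (((hCXp 18 1 3).mul (hX 2)).mul (hX 3)) (by norm_num))).add
      (isHomogeneous_of_deg_eq ((hCXp (-4) 1 2).mul (hXp 2 3)) (by norm_num))
  have hPe' : Pe.IsHomogeneous 6 :=
    ((((isHomogeneous_of_deg_eq ((hCXp (-27) 0 2).mul (hXp 3 4)) (by norm_num)).add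
      (isHomogeneous_of_deg_eq ((((hCX 18 0).mul (hX 1)).mul (hX 2)).mul (hXp 3 3))
        (by norm_num))).add
      (isHomogeneous_of_deg_eq (((hCX (-4) 0).mul (hXp 2 3)).mul (hXp 3 2)) (by norm_num))).add
      (isHomogeneous_of_deg_eq ((hCXp (-4) 1 3).mul (hXp 3 3)) (by norm_num))).add
      (isHomogeneous_of_deg_eq (((hCXp 1 1 2).mul (hXp 2 2)).mul (hXp 3 2)) (by norm_num))
  have hL1 : (MvPolynomial.C 6 * Pa * Pc - MvPolynomial.C 2 * Pb ^ 2).IsHomogeneous 8 :=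
    (isHomogeneous_of_deg_eq ((hPa'.C_mul 6).mul hPc') (by norm_num)).sub
      (isHomogeneous_of_deg_eq ((hPb'.pow 2).C_mul 2) (by norm_num))
  have hL0 : (MvPolynomial.C 9 * Pa * Pe - Pb * Pc).IsHomogeneous 9 :=
    (isHomogeneous_of_deg_eq ((hPa'.C_mul 9).mul hPe') (by norm_num)).sub
      (isHomogeneous_of_deg_eq (hPb'.mul hPc') (by norm_num))
  have hPh : P.IsHomogeneous 21 :=
    ((isHomogeneous_of_deg_eq (hPc'.mul (hL1.pow 2)) (by norm_num)).sub
      (isHomogeneous_of_deg_eq (((hPb'.C_mul 2).mul hL0).mul hL1) (by norm_num))).add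
      (isHomogeneous_of_deg_eq ((hPa'.C_mul 3).mul (hL0.pow 2)) (by norm_num))
  have hdeg : P.totalDegree ≤ 21 := hPh.totalDegree_le
  -- evaluation
  have heval : ∀ y : Fin 4 → ℤ, MvPolynomial.eval y P =
      (let a := y 0; let b := y 1; let c := y 2; let d := y 3
       let A := 256 * a ^ 3
       let B := -192 * a ^ 2 * b * d - 128 * a ^ 2 * c ^ 2 + 144 * a * b ^ 2 * c - 27 * b ^ 4
       let C := 144 * a ^ 2 * c * d ^ 2 - 6 * a * b ^ 2 * d ^ 2 - 80 * a * b * c ^ 2 * d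
         + 16 * a * c ^ 4 + 18 * b ^ 3 * c * d - 4 * b ^ 2 * c ^ 3
       let E := -27 * a ^ 2 * d ^ 4 + 18 * a * b * c * d ^ 3 - 4 * a * c ^ 3 * d ^ 2
         - 4 * b ^ 3 * d ^ 3 + b ^ 2 * c ^ 2 * d ^ 2
       C * (6 * A * C - 2 * B ^ 2) ^ 2 - 2 * B * (9 * A * E - B * C) * (6 * A * C - 2 * B ^ 2)
         + 3 * A * (9 * A * E - B * C) ^ 2) := by
    intro y
    simp only [hP, hPa, hPb, hPc, hPe, map_add, map_sub, map_mul, map_pow, MvPolynomial.eval_C,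
      MvPolynomial.eval_X]
    ring
  -- nonvanishing at `(1,1,1,1)`
  have hP0 : P ≠ 0 := by
    intro h0
    have := heval fun _ => 1
    rw [h0, map_zero] at this
    norm_num at this
  -- Schwartz–Zippel
  have hSZ := MvPolynomial.schwartz_zippel_totalDegree hP0 S
  have hset : ((Fintype.piFinset fun _ : Fin 4 => S).filter fun y : Fin 4 → ℤ =>
        MvPolynomial.eval y P = 0) =
      ((Fintype.piFinset fun _ : Fin 4 => S).filter fun y : Fin 4 → ℤ =>
        (let a := y 0; let b := y 1; let c := y 2; let d := y 3
         let A := 256 * a ^ 3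
         let B := -192 * a ^ 2 * b * d - 128 * a ^ 2 * c ^ 2 + 144 * a * b ^ 2 * c - 27 * b ^ 4
         let C := 144 * a ^ 2 * c * d ^ 2 - 6 * a * b ^ 2 * d ^ 2 - 80 * a * b * c ^ 2 * d
           + 16 * a * c ^ 4 + 18 * b ^ 3 * c * d - 4 * b ^ 2 * c ^ 3
         let E := -27 * a ^ 2 * d ^ 4 + 18 * a * b * c * d ^ 3 - 4 * a * c ^ 3 * d ^ 2
           - 4 * b ^ 3 * d ^ 3 + b ^ 2 * c ^ 2 * d ^ 2
         C * (6 * A * C - 2 * B ^ 2) ^ 2 - 2 * B * (9 * A * E - B * C) * (6 * A * C - 2 * B ^ 2)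
           + 3 * A * (9 * A * E - B * C) ^ 2 = 0)) :=
    filter_congr fun y _ => by rw [heval y]
  rw [← hset]
  rcases S.eq_empty_or_nonempty with rfl | hne
  · have : (Fintype.piFinset fun _ : Fin 4 => (∅ : Finset ℤ)) = ∅ := Fintype.piFinset_empty
    simp [this]
  have hs : (0 : ℚ≥0) < S.card := by exact_mod_cast hne.card_pos
  rw [div_le_div_iff₀ (by positivity) hs] at hSZ
  have h2 : (((Fintype.piFinset fun _ : Fin 4 => S).filter fun y : Fin 4 → ℤ =>
        MvPolynomial.eval y P = 0).card : ℚ≥0) * S.card ≤ (21 * (S.card : ℚ≥0) ^ 3) * S.card := by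
    calc _ ≤ (P.totalDegree : ℚ≥0) * (S.card : ℚ≥0) ^ 4 := hSZ
      _ ≤ (21 : ℚ≥0) * (S.card : ℚ≥0) ^ 4 := by gcongr; exact_mod_cast hdeg
      _ = (21 * (S.card : ℚ≥0) ^ 3) * S.card := by ring
  exact_mod_cast le_of_mul_le_mul_right h2 hs


/-! ## §6. Large primes: `#{f ∈ [−T,T]⁵ : f (mod p) ∈ Y(𝔽_p) for some prime p > T} ≤ 441·(2T+1)⁴` -/

/-- Membership in `[−T, T]` is `|x| ≤ T`. [folklore] -/
theorem mem_Icc_neg_iff {T : ℕ} {x : ℤ} : x ∈ Icc (-(T : ℤ)) T ↔ |x| ≤ T := by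
  rw [mem_Icc, abs_le]

/-- **The large-prime case of the geometric sieve for `Y = {Δ = ∂Δ/∂e = 0}` (Bhargava–Shankar
2015, Thm 2.17 = [geosieve, Thm 3.3], as applied in Thm 2.18), coefficient-vector form.** For
`T ≥ 3`, the integer vectors `(a,b,c,d,e) ∈ [−T,T]⁵` for which some prime `p > T` divides both
`Δ(a,b,c,d,e)` and `∂Δ/∂e(a,b,c,d,e)` number at most `441·(2T+1)⁴`: those on the hypersurface
`R₀(a,b,c,d) = 0` are at most `21(2T+1)³·(2T+1)` (`card_filter_cubicResultant_eq_zero_le`), and for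
each of the other `≤ (2T+1)⁴` quadruples `(a,b,c,d)` such a prime is one of the `≤ 70` prime
factors `> T` of `R₀(a,b,c,d)` (`dvd_cubicResultant_of_dvd_disc`,
`card_primeFactors_cubicResultant_le`), each allowing `≤ 6` values of `e`
(`card_filter_Icc_dvd_disc_le_six`). This replaces, for this `Y`, the range `p > r` of the source's
`O(rⁿ/(M^{k−1} log M) + r^{n−k+1})` (`n = 5`, `k = 2`, `r = T`). [cite: BhargavaShankarAnnals2015, §2.6, Thms 2.17–2.18 (published numbering)] -/
theorem card_filter_exists_prime_gt_le {T : ℕ} (hT : 3 ≤ T) :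
    (((Fintype.piFinset fun _ : Fin 4 => Icc (-(T : ℤ)) T) ×ˢ Icc (-(T : ℤ)) T).filter
        fun x : (Fin 4 → ℤ) × ℤ => ∃ p : ℕ, p.Prime ∧ T < p ∧
          (p : ℤ) ∣ (⟨x.1 0, x.1 1, x.1 2, x.1 3, x.2⟩ : BinaryQuartic ℤ).disc ∧
          (p : ℤ) ∣ (⟨x.1 0, x.1 1, x.1 2, x.1 3, x.2⟩ : BinaryQuartic ℤ).discDerivE).card
      ≤ 441 * (2 * T + 1) ^ 4 := by
  classical
  set I : Finset ℤ := Icc (-(T : ℤ)) T with hIdef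
  set Box4 : Finset (Fin 4 → ℤ) := Fintype.piFinset fun _ : Fin 4 => I with hBox4def
  have hI : I.card = 2 * T + 1 := by rw [hIdef, Int.card_Icc]; omega
  have hBox4 : Box4.card = (2 * T + 1) ^ 4 := by
    rw [hBox4def, Fintype.card_piFinset, prod_const, hI, card_univ, Fintype.card_fin]
  -- the resultant as a function of the first four coordinates
  let R0 : (Fin 4 → ℤ) → ℤ := fun y =>
    let a := y 0; let b := y 1; let c := y 2; let d := y 3
    let A := 256 * a ^ 3
    let B := -192 * a ^ 2 * b * d - 128 * a ^ 2 * c ^ 2 + 144 * a * b ^ 2 * c - 27 * b ^ 4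
    let C := 144 * a ^ 2 * c * d ^ 2 - 6 * a * b ^ 2 * d ^ 2 - 80 * a * b * c ^ 2 * d
      + 16 * a * c ^ 4 + 18 * b ^ 3 * c * d - 4 * b ^ 2 * c ^ 3
    let E := -27 * a ^ 2 * d ^ 4 + 18 * a * b * c * d ^ 3 - 4 * a * c ^ 3 * d ^ 2
      - 4 * b ^ 3 * d ^ 3 + b ^ 2 * c ^ 2 * d ^ 2
    C * (6 * A * C - 2 * B ^ 2) ^ 2 - 2 * B * (9 * A * E - B * C) * (6 * A * C - 2 * B ^ 2)
      + 3 * A * (9 * A * E - B * C) ^ 2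
  set bad : (Fin 4 → ℤ) × ℤ → Prop := fun x => ∃ p : ℕ, p.Prime ∧ T < p ∧
      (p : ℤ) ∣ (⟨x.1 0, x.1 1, x.1 2, x.1 3, x.2⟩ : BinaryQuartic ℤ).disc ∧
      (p : ℤ) ∣ (⟨x.1 0, x.1 1, x.1 2, x.1 3, x.2⟩ : BinaryQuartic ℤ).discDerivE with hbad
  -- split along `R₀ = 0`
  have hsplit : (Box4 ×ˢ I).filter bad ⊆
      ((Box4 ×ˢ I).filter fun x => R0 x.1 = 0) ∪
        ((Box4 ×ˢ I).filter fun x => R0 x.1 ≠ 0 ∧ bad x) := by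
    intro x hx
    simp only [mem_filter, mem_union] at hx ⊢
    by_cases h : R0 x.1 = 0
    · exact Or.inl ⟨hx.1, h⟩
    · exact Or.inr ⟨hx.1, h, hx.2⟩
  -- the hypersurface part
  have hzero : ((Box4 ×ˢ I).filter fun x => R0 x.1 = 0).card ≤ 21 * (2 * T + 1) ^ 3 * (2 * T + 1) := by
    rw [filter_product_left (fun y : Fin 4 → ℤ => R0 y = 0), card_product, hI]
    exact Nat.mul_le_mul_right _ ((card_filter_cubicResultant_eq_zero_le I).trans (by rw [hI]))
  -- the generic part, fibrewise
  have hfib : ∀ y ∈ Box4, (I.filter fun e => R0 y ≠ 0 ∧ bad (y, e)).card ≤ 420 := by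
    intro y hy
    have hyI : ∀ i, |y i| ≤ T := fun i => mem_Icc_neg_iff.mp (Fintype.mem_piFinset.mp hy i)
    by_cases hR : R0 y = 0
    · have : (I.filter fun e => R0 y ≠ 0 ∧ bad (y, e)) = ∅ :=
        filter_eq_empty_iff.mpr fun e _ h => h.1 hR
      simp [this]
    -- the primes in question divide `R₀(y) ≠ 0`
    set P : Finset ℕ := (R0 y).natAbs.primeFactors.filter fun p => T < p with hPdef
    have hPcard : P.card ≤ 70 :=
      card_primeFactors_cubicResultant_le (by omega) (hyI 0) (hyI 1) (hyI 2) (hyI 3)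
        rfl rfl rfl rfl hR
    have hsub : (I.filter fun e => R0 y ≠ 0 ∧ bad (y, e)) ⊆
        P.biUnion fun p => I.filter fun e : ℤ =>
          (p : ℤ) ∣ (⟨y 0, y 1, y 2, y 3, e⟩ : BinaryQuartic ℤ).disc := by
      intro e he
      simp only [mem_filter, hbad] at he
      obtain ⟨heI, -, p, hp, hTp, h1, h2⟩ := he
      simp only [mem_biUnion, mem_filter, hPdef, Nat.mem_primeFactors]
      refine ⟨p, ⟨⟨hp, ?_, Int.natAbs_ne_zero.mpr hR⟩, hTp⟩, heI, h1⟩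
      exact Int.natCast_dvd.mp
        (dvd_cubicResultant_of_dvd_disc (⟨y 0, y 1, y 2, y 3, e⟩ : BinaryQuartic ℤ)
          rfl rfl rfl rfl h1 h2)
    calc _ ≤ (P.biUnion fun p => I.filter fun e : ℤ =>
          (p : ℤ) ∣ (⟨y 0, y 1, y 2, y 3, e⟩ : BinaryQuartic ℤ).disc).card := card_le_card hsub
      _ ≤ ∑ p ∈ P, (I.filter fun e : ℤ =>
          (p : ℤ) ∣ (⟨y 0, y 1, y 2, y 3, e⟩ : BinaryQuartic ℤ).disc).card := card_biUnion_le
      _ ≤ ∑ p ∈ P, 6 := sum_le_sum fun p hp => by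
          have hp' := (mem_filter.mp hp)
          exact card_filter_Icc_dvd_disc_le_six hT (Nat.prime_of_mem_primeFactors hp'.1) hp'.2
            (hyI 0) (hyI 1) rfl rfl rfl rfl hR
      _ = 6 * P.card := by rw [sum_const, smul_eq_mul, mul_comm]
      _ ≤ 6 * 70 := Nat.mul_le_mul_left _ hPcard
      _ = 420 := rfl
  have hgen : ((Box4 ×ˢ I).filter fun x => R0 x.1 ≠ 0 ∧ bad x).card ≤ 420 * (2 * T + 1) ^ 4 := by
    calc _ = ∑ y ∈ Box4, (I.filter fun e => R0 y ≠ 0 ∧ bad (y, e)).card := by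
          rw [card_filter, sum_product]
          exact sum_congr rfl fun y _ => (card_filter _ _).symm
      _ ≤ ∑ y ∈ Box4, 420 := sum_le_sum hfib
      _ = 420 * (2 * T + 1) ^ 4 := by rw [sum_const, smul_eq_mul, hBox4, mul_comm]
  calc _ ≤ (((Box4 ×ˢ I).filter fun x => R0 x.1 = 0) ∪
          ((Box4 ×ˢ I).filter fun x => R0 x.1 ≠ 0 ∧ bad x)).card := card_le_card hsplit
    _ ≤ _ := card_union_le _ _
    _ ≤ 21 * (2 * T + 1) ^ 3 * (2 * T + 1) + 420 * (2 * T + 1) ^ 4 := add_le_add hzero hgen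
    _ = 441 * (2 * T + 1) ^ 4 := by ring

/-- **The large-prime case of the geometric sieve for binary quartic forms (box version).** For
`T ≥ 3` and any finite set `B` of integral binary quartic forms with all coefficients in `[−T, T]`,
the forms `f ∈ B` whose reduction modulo some prime `p > T` lies in
`Y(𝔽_p) = {Δ = ∂Δ/∂e = 0}` — i.e. `p ∣ Δ(f)` and `p ∣ ∂Δ/∂e(f)` — number at most `441·(2T+1)⁴`
(Bhargava–Shankar 2015, Thm 2.18 via Thm 2.17 = [geosieve, Thm 3.3], range `p > r = X^{1/6}`,
there `O(X^{2/3})` for the region `𝓕^{(ε)}·R^{(i)}(X) ⊂ [−O(X^{1/6}), O(X^{1/6})]⁵`).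
[cite: BhargavaShankarAnnals2015, §2.6, Thms 2.17–2.18 (published numbering)] -/
theorem card_filter_exists_prime_gt_dvd_disc_le {T : ℕ} (hT : 3 ≤ T) (B : Finset (BinaryQuartic ℤ))
    (hB : ∀ f ∈ B, |f.a| ≤ T ∧ |f.b| ≤ T ∧ |f.c| ≤ T ∧ |f.d| ≤ T ∧ |f.e| ≤ T) :
    (B.filter fun f => ∃ p : ℕ, p.Prime ∧ T < p ∧ (p : ℤ) ∣ f.disc ∧ (p : ℤ) ∣ f.discDerivE).card
      ≤ 441 * (2 * T + 1) ^ 4 := by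
  classical
  refine le_trans ?_ (card_filter_exists_prime_gt_le hT)
  refine card_le_card_of_injOn (fun f => (![f.a, f.b, f.c, f.d], f.e)) (fun f hf => ?_)
    (fun f _ g _ h => ?_)
  · simp only [coe_filter, Set.mem_setOf_eq] at hf ⊢
    obtain ⟨hfB, hbad⟩ := hf
    obtain ⟨ha, hb, hc, hd, he⟩ := hB f hfB
    refine ⟨?_, by simpa using hbad⟩
    simp only [mem_product, Fintype.mem_piFinset, mem_Icc_neg_iff]
    refine ⟨fun i => ?_, he⟩
    fin_cases i <;> simpa
  · simp only [Prod.mk.injEq] at h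
    obtain ⟨h1, h2⟩ := h
    have h0 := congrFun h1 0
    have h1' := congrFun h1 1
    have h2' := congrFun h1 2
    have h3 := congrFun h1 3
    simp at h0 h1' h2' h3
    ext <;> assumption


/-! ## §7. Small primes: `#{f ∈ B : f (mod p) ∈ Y(𝔽_p)} ≤ 6p³·((2T+1)/p + 1)⁵` -/

/-- **Residue classes in a box.** For a prime `p ≥ 5` and a finite set `B` of integral forms with
coefficients in `[−T, T]`, the forms `f ∈ B` with `p ∣ Δ(f)` and `p ∣ ∂Δ/∂e(f)` number at most
`#Y(ℤ/p) · ((2T+1)/p + 1)⁵ ≤ 6p³ · ((2T+1)/p + 1)⁵`: reduction modulo `p` lands in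
`Y(ℤ/p) = {Δ = ∂Δ/∂e = 0}` (`card_filter_disc_eq_zero_discDerivE_eq_zero_le`), and each of the five
coefficients of a form with prescribed reduction runs over one residue class of `[−T, T]`. This is
the range `p ≤ r` of the geometric sieve (Bhargava–Shankar 2015, Thm 2.17 = [geosieve, Thm 3.3]:
the count `#{a ∈ rB ∩ ℤⁿ : a (mod p) ∈ Y(𝔽_p)} = O(#Y(𝔽_p)·(r/p)ⁿ) = O(rⁿ/pᵏ)`).
[cite: BhargavaShankarAnnals2015, §2.6, Thms 2.17–2.18 (published numbering)] -/
theorem card_filter_dvd_disc_dvd_discDerivE_le {T p : ℕ} (hp : p.Prime) (hp5 : 5 ≤ p)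
    (B : Finset (BinaryQuartic ℤ))
    (hB : ∀ f ∈ B, |f.a| ≤ T ∧ |f.b| ≤ T ∧ |f.c| ≤ T ∧ |f.d| ≤ T ∧ |f.e| ≤ T) :
    (B.filter fun f => (p : ℤ) ∣ f.disc ∧ (p : ℤ) ∣ f.discDerivE).card
      ≤ 6 * p ^ 3 * ((2 * T + 1) / p + 1) ^ 5 := by
  classical
  haveI := Fact.mk hp
  set I : Finset ℤ := Icc (-(T : ℤ)) T with hIdef
  set φ := Int.castRingHom (ZMod p) with hφ
  set Y : Finset (BinaryQuartic (ZMod p)) :=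
    univ.filter fun F : BinaryQuartic (ZMod p) => F.disc = 0 ∧ F.discDerivE = 0 with hYdef
  have hY : Y.card ≤ 6 * p ^ 3 := card_filter_disc_eq_zero_discDerivE_eq_zero_le hp5
  set m : ℕ := (2 * T + 1) / p + 1 with hmdef
  -- one residue class of `[−T, T]`
  have hcls : ∀ r : ZMod p, (I.filter fun t : ℤ => (t : ZMod p) = r).card ≤ m := by
    intro r
    rw [hIdef, Icc_neg_eq_Ico]
    exact card_filter_Ico_intCast_eq_le hp.pos _ _ r
  have key := card_le_mul_card_image_of_maps_to
    (s := B.filter fun f => (p : ℤ) ∣ f.disc ∧ (p : ℤ) ∣ f.discDerivE) (t := Y)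
    (f := fun f : BinaryQuartic ℤ => f.map φ) (fun f hf => ?_) (m ^ 5) (fun F _ => ?_)
  · calc _ ≤ m ^ 5 * Y.card := key
      _ ≤ m ^ 5 * (6 * p ^ 3) := Nat.mul_le_mul_left _ hY
      _ = 6 * p ^ 3 * ((2 * T + 1) / p + 1) ^ 5 := by rw [hmdef]; ring
  · simp only [mem_filter] at hf
    simp only [hYdef, mem_filter, mem_univ, true_and]
    exact (dvd_disc_and_dvd_discDerivE_iff f p).mp hf.2
  · -- the fibre over `F` injects into a product of five residue classes
    calc _ ≤ ((I.filter fun t : ℤ => (t : ZMod p) = F.a) ×ˢ ((I.filter fun t : ℤ => (t : ZMod p) = F.b)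
          ×ˢ ((I.filter fun t : ℤ => (t : ZMod p) = F.c) ×ˢ ((I.filter fun t : ℤ => (t : ZMod p) = F.d)
          ×ˢ (I.filter fun t : ℤ => (t : ZMod p) = F.e))))).card := by
          refine card_le_card_of_injOn (fun f => (f.a, (f.b, (f.c, (f.d, f.e)))))
            (fun f hf => ?_) (fun f _ g _ h => ?_)
          · simp only [coe_filter, Set.mem_setOf_eq, mem_filter] at hf
            obtain ⟨⟨hfB, -⟩, hfF⟩ := hf
            obtain ⟨ha, hb, hc, hd, he⟩ := hB f hfB
            have h5 : (φ f.a = F.a ∧ φ f.b = F.b) ∧ (φ f.c = F.c ∧ φ f.d = F.d ∧ φ f.e = F.e) := by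
              subst hfF; simp [BinaryQuartic.map]
            simp only [hφ, eq_intCast] at h5
            simp only [coe_product, coe_filter, Set.mem_prod, Set.mem_setOf_eq, hIdef,
              mem_Icc_neg_iff]
            exact ⟨⟨ha, h5.1.1⟩, ⟨hb, h5.1.2⟩, ⟨hc, h5.2.1⟩, ⟨hd, h5.2.2.1⟩, ⟨he, h5.2.2.2⟩⟩
          · simp only [Prod.mk.injEq] at h
            obtain ⟨h1, h2, h3, h4, h5⟩ := h
            ext <;> assumption
      _ ≤ m * (m * (m * (m * m))) := by
          simp only [card_product]
          exact Nat.mul_le_mul (hcls _) (Nat.mul_le_mul (hcls _) (Nat.mul_le_mul (hcls _)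
            (Nat.mul_le_mul (hcls _) (hcls _))))
      _ = m ^ 5 := by ring

/-! ## §8. All primes `p > M`: the geometric sieve for `Y = {Δ = ∂Δ/∂e = 0}` in a box -/

/-- `∑_{M < n ≤ N} 1/(n(n−1)) = 1/M − 1/N` (`1 ≤ M ≤ N`). [folklore] -/
theorem sum_Ioc_one_div_mul_pred {M N : ℕ} (hM : 1 ≤ M) (hMN : M ≤ N) :
    ∑ n ∈ Ioc M N, (1 : ℝ) / ((n : ℝ) * ((n : ℝ) - 1)) = 1 / M - 1 / N := by
  induction N, hMN using Nat.le_induction with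
  | base => simp
  | succ N hMN ih =>
      rw [sum_Ioc_succ_top hMN, ih]
      have hN : (1 : ℝ) ≤ N := by exact_mod_cast hM.trans hMN
      have hN0 : (N : ℝ) ≠ 0 := by positivity
      have hM0 : (M : ℝ) ≠ 0 := by
        have : (1 : ℝ) ≤ M := by exact_mod_cast hM
        positivity
      have hN1 : ((N + 1 : ℕ) : ℝ) - 1 = N := by push_cast; ring
      have hN2 : ((N + 1 : ℕ) : ℝ) ≠ 0 := by positivity
      rw [hN1]
      field_simp
      push_cast
      ring

/-- `∑_{M < p ≤ N, p prime} 1/p² ≤ 1/M` (`M ≥ 1`). [folklore] -/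
theorem sum_primes_Ioc_one_div_sq_le {M N : ℕ} (hM : 1 ≤ M) :
    ∑ p ∈ (Ioc M N).filter Nat.Prime, (1 : ℝ) / (p : ℝ) ^ 2 ≤ 1 / M := by
  rcases le_or_gt M N with hMN | hNM
  · calc _ ≤ ∑ n ∈ Ioc M N, (1 : ℝ) / (n : ℝ) ^ 2 :=
          sum_le_sum_of_subset_of_nonneg (filter_subset _ _) fun n _ _ => by positivity
      _ ≤ ∑ n ∈ Ioc M N, (1 : ℝ) / ((n : ℝ) * ((n : ℝ) - 1)) := sum_le_sum fun n hn => by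
          have hn : M + 1 ≤ n := (mem_Ioc.mp hn).1
          have hn1 : (2 : ℝ) ≤ n := by exact_mod_cast (by omega : 2 ≤ n)
          apply one_div_le_one_div_of_le
          · nlinarith
          · nlinarith
      _ = 1 / M - 1 / N := sum_Ioc_one_div_mul_pred hM hMN
      _ ≤ 1 / M := by
          have : (0 : ℝ) ≤ 1 / N := by positivity
          linarith
  · have : Ioc M N = ∅ := Finset.Ioc_eq_empty (by omega)
    simp [this]

/-- **The geometric sieve for binary quartic forms at `Y = {Δ = ∂Δ/∂e = 0}`, in a box**
(Bhargava–Shankar 2015, Thm 2.18 via Thm 2.17 = [geosieve, Thm 3.3], with `M log M` weakened to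
`M`). For `T ≥ 3`, `M ≥ 4` and any finite set `B` of integral binary quartic forms with coefficients
in `[−T, T]`:
`#{f ∈ B : p ∣ Δ(f) and p ∣ ∂Δ/∂e(f) for some prime p > M} ≤ 6144·T⁵/M + 441·(2T+1)⁴` —
primes `M < p ≤ T` contribute `≤ 6p³((2T+1)/p + 1)⁵ ≤ 6144 T⁵/p²` each
(`card_filter_dvd_disc_dvd_discDerivE_le`) and `∑_{p > M} p⁻² ≤ 1/M`; primes `p > T` contribute
`≤ 441(2T+1)⁴` in all (`card_filter_exists_prime_gt_dvd_disc_le`). Applied to the lattice points of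
the homogeneously expanding region `𝓕^{(ε)}·R^{(i)}(X) ⊂ [−O(X^{1/6}), O(X^{1/6})]⁵` this is the
bound `O(X^{5/6}/M + X^{2/3})` for `∪_{p > M} W_p^{(1)}` of Thm 2.18.
[cite: BhargavaShankarAnnals2015, §2.6, Thm 2.18 (published numbering)] -/
theorem card_filter_exists_prime_gt_dvd_disc_dvd_discDerivE_le {T M : ℕ} (hT : 3 ≤ T) (hM : 4 ≤ M)
    (B : Finset (BinaryQuartic ℤ))
    (hB : ∀ f ∈ B, |f.a| ≤ T ∧ |f.b| ≤ T ∧ |f.c| ≤ T ∧ |f.d| ≤ T ∧ |f.e| ≤ T) :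
    ((B.filter fun f => ∃ p : ℕ, p.Prime ∧ M < p ∧ (p : ℤ) ∣ f.disc ∧ (p : ℤ) ∣ f.discDerivE).card
        : ℝ) ≤ 6144 * (T : ℝ) ^ 5 / M + 441 * (2 * (T : ℝ) + 1) ^ 4 := by
  classical
  set Prm : Finset ℕ := (Ioc M T).filter Nat.Prime with hPrm
  -- split the primes at `T`
  have hsplit : (B.filter fun f => ∃ p : ℕ, p.Prime ∧ M < p ∧ (p : ℤ) ∣ f.disc ∧ (p : ℤ) ∣ f.discDerivE)
      ⊆ (Prm.biUnion fun p => B.filter fun f => (p : ℤ) ∣ f.disc ∧ (p : ℤ) ∣ f.discDerivE) ∪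
        (B.filter fun f => ∃ p : ℕ, p.Prime ∧ T < p ∧ (p : ℤ) ∣ f.disc ∧ (p : ℤ) ∣ f.discDerivE) := by
    intro f hf
    simp only [mem_filter] at hf
    obtain ⟨hfB, p, hp, hMp, h1, h2⟩ := hf
    simp only [mem_union, mem_biUnion, mem_filter, hPrm, mem_Ioc]
    by_cases hpT : p ≤ T
    · exact Or.inl ⟨p, ⟨⟨hMp, hpT⟩, hp⟩, hfB, h1, h2⟩
    · exact Or.inr ⟨hfB, p, hp, not_le.mp hpT, h1, h2⟩
  have hsmall : ((Prm.biUnion fun p => B.filter fun f =>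
      (p : ℤ) ∣ f.disc ∧ (p : ℤ) ∣ f.discDerivE).card : ℝ) ≤ 6144 * (T : ℝ) ^ 5 / M := by
    calc _ ≤ ((∑ p ∈ Prm, (B.filter fun f => (p : ℤ) ∣ f.disc ∧ (p : ℤ) ∣ f.discDerivE).card : ℕ) : ℝ) := by
          exact_mod_cast card_biUnion_le
      _ ≤ ∑ p ∈ Prm, (6144 * (T : ℝ) ^ 5) * (1 / (p : ℝ) ^ 2) := by
          push_cast
          refine sum_le_sum fun p hp => ?_
          simp only [hPrm, mem_filter, mem_Ioc] at hp
          obtain ⟨⟨hMp, hpT⟩, hpp⟩ := hp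
          have hp5 : 5 ≤ p := by omega
          have hp0 : (0 : ℝ) < p := by exact_mod_cast hpp.pos
          have h1 := card_filter_dvd_disc_dvd_discDerivE_le (T := T) hpp hp5 B hB
          calc ((B.filter fun f => (p : ℤ) ∣ f.disc ∧ (p : ℤ) ∣ f.discDerivE).card : ℝ)
                ≤ ((6 * p ^ 3 * ((2 * T + 1) / p + 1) ^ 5 : ℕ) : ℝ) := by exact_mod_cast h1
            _ ≤ 6 * (p : ℝ) ^ 3 * (((2 * T + 1 : ℕ) : ℝ) / p + 1) ^ 5 := by
                have hdiv : (((2 * T + 1) / p : ℕ) : ℝ) ≤ ((2 * T + 1 : ℕ) : ℝ) / (p : ℝ) :=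
                  Nat.cast_div_le
                push_cast at hdiv ⊢
                gcongr
            _ ≤ 6 * (p : ℝ) ^ 3 * (4 * (T : ℝ) / p) ^ 5 := by
                gcongr
                rw [div_add_one hp0.ne', div_le_div_iff_of_pos_right hp0]
                push_cast
                have : (p : ℝ) ≤ T := by exact_mod_cast hpT
                have : (1 : ℝ) ≤ T := by exact_mod_cast (by omega : 1 ≤ T)
                linarith
            _ = (6144 * (T : ℝ) ^ 5) * (1 / (p : ℝ) ^ 2) := by
                field_simp
                ring
      _ = (6144 * (T : ℝ) ^ 5) * ∑ p ∈ Prm, 1 / (p : ℝ) ^ 2 := by rw [mul_sum]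
      _ ≤ (6144 * (T : ℝ) ^ 5) * (1 / M) := by
          gcongr
          exact sum_primes_Ioc_one_div_sq_le (by omega)
      _ = 6144 * (T : ℝ) ^ 5 / M := by ring
  have hlarge := card_filter_exists_prime_gt_dvd_disc_le hT B hB
  calc _ ≤ (((Prm.biUnion fun p => B.filter fun f => (p : ℤ) ∣ f.disc ∧ (p : ℤ) ∣ f.discDerivE) ∪
          (B.filter fun f => ∃ p : ℕ, p.Prime ∧ T < p ∧ (p : ℤ) ∣ f.disc ∧
            (p : ℤ) ∣ f.discDerivE)).card : ℝ) := by exact_mod_cast card_le_card hsplit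
    _ ≤ ((Prm.biUnion fun p => B.filter fun f => (p : ℤ) ∣ f.disc ∧ (p : ℤ) ∣ f.discDerivE).card : ℝ)
        + ((B.filter fun f => ∃ p : ℕ, p.Prime ∧ T < p ∧ (p : ℤ) ∣ f.disc ∧
            (p : ℤ) ∣ f.discDerivE).card : ℝ) := by exact_mod_cast card_union_le _ _
    _ ≤ 6144 * (T : ℝ) ^ 5 / M + 441 * (2 * (T : ℝ) + 1) ^ 4 := by
        refine add_le_add hsmall ?_
        exact_mod_cast hlarge

/-- **Corollary for `W_p^{(1)}` (strong divisibility).** With `B`, `T ≥ 3`, `M ≥ 4` as above, the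
forms `f ∈ B` whose discriminant is *strongly* divisible by `p²` for some prime `p > M` — `p² ∣
Δ(a,b,c,d,e + pt)` for all `t` (then `f (mod p) ∈ Y(𝔽_p)`,
`dvd_disc_and_dvd_discDerivE_of_forall_sq_dvd`) — number at most `6144·T⁵/M + 441·(2T+1)⁴`: the
content of Bhargava–Shankar 2015, Thm 2.18
("`#{𝓕^{(ε)}·R^{(i)}(X) ∩ (∪_{p>M} W_p^{(1)}(V))} = O(X^{5/6}/(M log M) + X^{2/3})`", here with
`M` for `M log M`) for boxes of side `≍ X^{1/6}`. [cite: BhargavaShankarAnnals2015, §2.6, Thm 2.18 (published numbering)] -/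
theorem card_filter_exists_prime_gt_stronglyDivisible_le {T M : ℕ} (hT : 3 ≤ T) (hM : 4 ≤ M)
    (B : Finset (BinaryQuartic ℤ))
    (hB : ∀ f ∈ B, |f.a| ≤ T ∧ |f.b| ≤ T ∧ |f.c| ≤ T ∧ |f.d| ≤ T ∧ |f.e| ≤ T) :
    ((B.filter fun f => ∃ p : ℕ, p.Prime ∧ M < p ∧
        ∀ t : ℤ, (p : ℤ) ^ 2 ∣ (⟨f.a, f.b, f.c, f.d, f.e + p * t⟩ : BinaryQuartic ℤ).disc).card : ℝ)
      ≤ 6144 * (T : ℝ) ^ 5 / M + 441 * (2 * (T : ℝ) + 1) ^ 4 := by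
  classical
  refine le_trans ?_ (card_filter_exists_prime_gt_dvd_disc_dvd_discDerivE_le hT hM B hB)
  have hsub : (B.filter fun f => ∃ p : ℕ, p.Prime ∧ M < p ∧
        ∀ t : ℤ, (p : ℤ) ^ 2 ∣ (⟨f.a, f.b, f.c, f.d, f.e + p * t⟩ : BinaryQuartic ℤ).disc)
      ⊆ (B.filter fun f => ∃ p : ℕ, p.Prime ∧ M < p ∧ (p : ℤ) ∣ f.disc ∧ (p : ℤ) ∣ f.discDerivE) := by
    intro f hf
    simp only [mem_filter] at hf ⊢
    obtain ⟨hfB, p, hp, hMp, h⟩ := hf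
    exact ⟨hfB, p, hp, hMp,
      dvd_disc_and_dvd_discDerivE_of_forall_sq_dvd f (Nat.prime_iff_prime_int.mp hp) h⟩
  exact_mod_cast card_le_card hsub

end BinaryQuartic

end Literature.NumberTheory.EllipticCurves

end
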